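import Mathlib
import Summits.HodgeConjecture.HodgeConjecture.Theorems.PadicSemiregularLiftHodgeAbelianVarietiesAndreImageRestrict
import Summits.HodgeConjecture.HodgeConjecture.Theorems.PadicSemiregularLiftHodgeAbelianVarietiesAndreEigenTransport
import Summits.HodgeConjecture.HodgeConjecture.Theorems.PadicSemiregularLiftHodgeAbelianVarietiesAndrePowerHOne
import Summits.HodgeConjecture.HodgeConjecture.Theorems.PadicSemiregularLiftHodgeAbelianVarietiesCMPivotBridge
import Literature.AlgebraicGeometry.HodgeTheory.WeilClasses
import Literature.AlgebraicGeometry.HodgeTheory.HodgeTypeExteriorProduct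
import Literature.AlgebraicGeometry.HodgeTheory.HodgeTypeConjugation
import Literature.AlgebraicGeometry.Motives.AbelianVarietyProjectiveChart

/-!
# Crux `HodgeAbelianVarieties` (stmt-HodgeConjecture-1333), line `cm-pivot-andre` — André with CM targets, module L4: the targets `B_α = im u_α`

For one of André's idempotents `u = u_α` on `B = A ⊗ O_E` (`u² = N u`, diagonal on the line basis `𝔅(λ,s)` with value
`N` on the index set `I_α = {(λ,s) | e_s⁻¹ λ ∈ α}` and `0` elsewhere), commuting with the Weil endomorphism `Y = θ`
(eigenvalue `ρ_s` on `𝔅(λ,s)`, the `ρ_s` distinct and non-real) and with a "CM endomorphism" `V` (eigenvalues `val`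
injective on `I_α`), the target `B_α := im u` (`Motives.AbelianVariety.image u`) satisfies (`work/andre/PLAN.md` §8):
it has a CM subalgebra (crux typing, from the restriction of `V` and the landed bridge `cmSubalgebra_of_isCM`); the
restriction `ψ` of `Y` has eigenvalues exactly the `ρ_s`, each with multiplicity `|α| = d`, exhausting `H¹(B_α)`;
and every class `w ∈ Hᵈ(B)` with `u^* w = N^d w` splitting into `Y`-Weil columns descends to a class
`t = N^{-d} (im u ↪ B)^* w` on `B_α` with `(B ↠ im u)^* t = w`, rational and of type `(p,q)` when `w` is, and
lying in the Weil eigen-span of `ψ`. Tools: restriction of commuting endomorphisms to the image (W2), eigenspace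
transport along the injective `(B ↠ im u)^*` (W8), `H¹` exactness (tree).
-/

set_option linter.dupNamespace false

noncomputable section

namespace Summit.HodgeConjecture.HodgeConjecture.Theorems.HodgeAbelianVarieties.CMPivotAndre

open CategoryTheory
open Literature.AlgebraicTopology.SingularHomology
open Literature.AlgebraicGeometry Literature.AlgebraicGeometry.Motives Literature.AlgebraicGeometry.HodgeTheory
open Literature.AlgebraicGeometry.Motives.AbelianVariety

/-- **André's targets.** See the module docstring. [cite: Andre1992HodgeCM, Théorème]
[cite: Deligne1982HodgeCycles, §4 (4.4)] [cite: LangeBirkenhake1992, §1.1 Prop. 1.1.10 and Prop. 1.1.12] -/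
theorem andre_target : ∀ {N n d Nd : ℕ} (B : Literature.AlgebraicGeometry.Motives.AbelianVariety ℂ) (u Y V : B ⟶ B) (𝔅 : Module.Basis (Fin N × Fin n) ℂ (Literature.AlgebraicGeometry.HodgeTheory.complexBetti B.X 1)) (ρ : Fin n → ℂ) (val : Fin N × Fin n → ℂ) (α : Finset (Fin N)) (e : Fin n → Equiv.Perm (Fin N)), 0 < d → 0 < Nd → α.card = d → Function.Injective ρ → (∀ s, (ρ s).im ≠ 0) → u ≫ Y = Y ≫ u → u ≫ V = V ≫ u → (∀ l s, Literature.AlgebraicGeometry.HodgeTheory.complexBetti.map Y.hom.hom.hom 1 (𝔅 (l, s)) = ρ s • 𝔅 (l, s)) → (∀ l s, Literature.AlgebraicGeometry.HodgeTheory.complexBetti.map V.hom.hom.hom 1 (𝔅 (l, s)) = val (l, s) • 𝔅 (l, s)) → (∀ i j : Fin N × Fin n, (e i.2).symm i.1 ∈ α → (e j.2).symm j.1 ∈ α → val i = val j → i = j) → (∀ l s, Literature.AlgebraicGeometry.HodgeTheory.complexBetti.map u.hom.hom.hom 1 (𝔅 (l, s)) = (if (e s).symm l ∈ α then (Nd :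 ℂ) else 0) • 𝔅 (l, s)) → 2 * (Literature.AlgebraicGeometry.Motives.AbelianVariety.image u).dim = α.card * n → ∃ ψ : Literature.AlgebraicGeometry.Motives.AbelianVariety.image u ⟶ Literature.AlgebraicGeometry.Motives.AbelianVariety.image u, (∃ S : Subalgebra ℚ (Literature.AlgebraicGeometry.Motives.AbelianVariety.endAlgebra (Literature.AlgebraicGeometry.Motives.AbelianVariety.image u)), IsReduced ↥S ∧ (∀ x ∈ S, ∀ y ∈ S, x * y = y * x) ∧ Module.finrank ℚ ↥S = 2 * Literature.AlgebraicGeometry.Motives.AbelianVariety.dim (Literature.AlgebraicGeometry.Motives.AbelianVariety.image u)) ∧ (∀ μ ∈ Finset.univ.image ρ, μ.im ≠ 0) ∧ (⨆ μ ∈ Finset.univ.image ρ, Module.End.eigenspace (Literature.AlgebraicGeometry.HodgeTheory.complexBetti.map ψ.hom.hom.hom 1).hom μ) = ⊤ ∧ (∀ μ ∈ Finset.univ.image ρ, Module.finrank ℂ (Module.End.eigenspace (Literature.AlgebraicGeometry.HodgeTheory.complexBetti.map ψ.hom.hom.hom 1).hom μ) = d) ∧ (∀ (w : Literature.AlgebraicGeometry.HodgeTheory.complexBetti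 B.X d) (ws : Fin n → Literature.AlgebraicGeometry.HodgeTheory.complexBetti B.X d), Literature.AlgebraicGeometry.HodgeTheory.complexBetti.map u.hom.hom.hom d w = ((Nd : ℂ) ^ d) • w → w = ∑ s, ws s → (∀ (s : Fin n) (x y' : ℕ), Literature.AlgebraicGeometry.HodgeTheory.complexBetti.map (x • 𝟙 B + y' • Y).hom.hom.hom d (ws s) = (((x : ℂ) + (y' : ℂ) * ρ s) ^ d) • ws s) → ∃ t : Literature.AlgebraicGeometry.HodgeTheory.complexBetti (Literature.AlgebraicGeometry.Motives.AbelianVariety.image u).X d, Literature.AlgebraicGeometry.HodgeTheory.complexBetti.map (Literature.AlgebraicGeometry.Motives.AbelianVariety.toImage u).hom.hom.hom d t = w ∧ (Literature.AlgebraicGeometry.HodgeTheory.IsRationalClass w → Literature.AlgebraicGeometry.HodgeTheory.IsRationalClass t) ∧ (∀ p q : ℕ, Literature.AlgebraicGeometry.HodgeTheory.IsOfHodgeType B.dim B.X d p q w → Literature.AlgebraicGeometry.HodgeTheory.IsOfHodgeType (Literature.AlgebraicGeometry.Motives.AbelianVariety.image u).dim (Literature.AlgebraicGeometry.Motives.AbelianVariety.image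 u).X d p q t) ∧ t ∈ ⨆ μ ∈ Finset.univ.image ρ, Literature.AlgebraicGeometry.HodgeTheory.pullbackEigenclasses (Literature.AlgebraicGeometry.Motives.AbelianVariety.image u) ψ d (fun x y => ((x : ℂ) + (y : ℂ) * μ) ^ d)) := by
  intro N n d Nd B u Y V 𝔅 ρ val α e hd hNd hα hρ hρim huY huV hY hV hval hu hdim
  classical
  haveI := finite_complexBetti_abelianVariety B 1
  haveI := finite_complexBetti_abelianVariety (image u) 1
  have hB : IsSmoothProjective B.dim B.X := AbelianVariety.isSmoothProjective_holds (A := B)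
  have hBα : IsSmoothProjective (image u).dim (image u).X := AbelianVariety.isSmoothProjective_holds (A := image u)
  -- the two restricted endomorphisms
  obtain ⟨ψ, hψs, hψq⟩ := exists_restrict_image_of_comm u Y huY
  obtain ⟨φ, hφs, hφq⟩ := exists_restrict_image_of_comm u V huV
  set q : B ⟶ image u := toImage u with hq
  set sι : image u ⟶ B := imageι u with hsι
  -- `q^*` is injective and intertwines
  have hqinj : Function.Injective (complexBetti.map q.hom.hom.hom 1) := by
    haveI : AlgebraicGeometry.Surjective (Hom.toSchemeHom (toImage u)) := inferInstance
    exact complexBetti_map_one_injective_of_surjective (toImage u)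
  have hsιsurj : Function.Surjective (complexBetti.map sι.hom.hom.hom 1) := by
    haveI : AlgebraicGeometry.IsClosedImmersion (Hom.toSchemeHom (imageι u)) := inferInstance
    exact complexBetti_map_one_surjective_of_isClosedImmersion (imageι u)
  have hinter : ∀ (g : image u ⟶ image u) (G : B ⟶ B), q ≫ g = G ≫ q →
      (complexBetti.map q.hom.hom.hom 1).hom ∘ₗ (complexBetti.map g.hom.hom.hom 1).hom =
        (complexBetti.map G.hom.hom.hom 1).hom ∘ₗ (complexBetti.map q.hom.hom.hom 1).hom := by
    intro g G h
    have := complexBetti_map_comp_hom q g 1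
    rw [h, complexBetti_map_comp_hom] at this
    have h2 := congrArg ModuleCat.Hom.hom this
    rw [ModuleCat.hom_comp, ModuleCat.hom_comp] at h2
    exact h2.symm
  -- the index set `Iα` and the eigen-family `b`
  let Iα : Type := {i : Fin N × Fin n // (e i.2).symm i.1 ∈ α}
  let b : Iα → complexBetti B.X 1 := fun i => 𝔅 i.1
  have hbli : LinearIndependent ℂ b := 𝔅.linearIndependent.comp _ Subtype.val_injective
  have hrange : LinearMap.range (complexBetti.map q.hom.hom.hom 1).hom = Submodule.span ℂ (Set.range b) := by
    -- `range q^* = range u^*` (`u = q ≫ sι`, `sι^*` onto) `= span {𝔅 i | i ∈ Iα}`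
    have hu_eq : complexBetti.map u.hom.hom.hom 1 = complexBetti.map sι.hom.hom.hom 1 ≫ complexBetti.map q.hom.hom.hom 1 := by
      rw [← complexBetti_map_comp_hom, hq, hsι, toImage_imageι]
    have h1 : LinearMap.range (complexBetti.map q.hom.hom.hom 1).hom =
        LinearMap.range (complexBetti.map u.hom.hom.hom 1).hom := by
      rw [hu_eq, ModuleCat.hom_comp, LinearMap.range_comp_of_range_eq_top]
      exact LinearMap.range_eq_top.mpr hsιsurj
    rw [h1]
    apply le_antisymm
    · rintro _ ⟨x, rfl⟩
      rw [← 𝔅.sum_repr x, map_sum]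
      refine Submodule.sum_mem _ fun i _ => ?_
      rw [map_smul]
      obtain ⟨l, s⟩ := i
      change (𝔅.repr x) (l, s) • complexBetti.map u.hom.hom.hom 1 (𝔅 (l, s)) ∈ _
      rw [hu]
      by_cases h : (e s).symm l ∈ α
      · rw [if_pos h]
        exact Submodule.smul_mem _ _ (Submodule.smul_mem _ _ (Submodule.subset_span ⟨⟨(l, s), h⟩, rfl⟩))
      · rw [if_neg h, zero_smul, smul_zero]; exact Submodule.zero_mem _
    · rw [Submodule.span_le]
      rintro _ ⟨⟨⟨l, s⟩, hls⟩, rfl⟩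
      refine ⟨(Nd : ℂ)⁻¹ • 𝔅 (l, s), ?_⟩
      change complexBetti.map u.hom.hom.hom 1 ((Nd : ℂ)⁻¹ • 𝔅 (l, s)) = 𝔅 (l, s)
      rw [map_smul, hu, if_pos hls, smul_smul, inv_mul_cancel₀ (Nat.cast_ne_zero.mpr hNd.ne'), one_smul]
  have hcardI : Fintype.card Iα = d * n := by
    have : Fintype.card Iα = (α ×ˢ (Finset.univ : Finset (Fin n))).card := by
      rw [Fintype.card_subtype]
      refine Finset.card_bij (fun ls _ => ((e ls.2).symm ls.1, ls.2)) ?_ ?_ ?_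
      · intro ls hls
        exact Finset.mem_product.mpr ⟨(Finset.mem_filter.mp hls).2, Finset.mem_univ _⟩
      · rintro ⟨l₁, s₁⟩ _ ⟨l₂, s₂⟩ _ h
        simp only [Prod.mk.injEq] at h
        obtain ⟨h1, rfl⟩ := h
        simp only [Prod.mk.injEq, and_true]
        exact (e s₁).symm.injective h1
      · rintro ⟨j, s⟩ hjs
        refine ⟨(e s j, s), Finset.mem_filter.mpr ⟨Finset.mem_univ _, ?_⟩, ?_⟩
        · simpa [Equiv.symm_apply_apply] using (Finset.mem_product.mp hjs).1
        · simp
    rw [this, Finset.card_product, Finset.card_univ, Fintype.card_fin, hα]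
  -- (A) the Weil endomorphism `ψ`: eigen-data transported from `Y`
  have hψtrans := eigenspace_transport (complexBetti.map q.hom.hom.hom 1).hom
    (complexBetti.map ψ.hom.hom.hom 1).hom (complexBetti.map Y.hom.hom.hom 1).hom hqinj (hinter ψ Y hψq) b
    (fun i => ρ i.1.2) hbli (fun i => hY i.1.1 i.1.2) hrange
  have himg_eq : (Finset.univ.image fun i : Iα => ρ i.1.2) = Finset.univ.image ρ := by
    ext μ
    simp only [Finset.mem_image, Finset.mem_univ, true_and]
    constructor
    · rintro ⟨i, rfl⟩; exact ⟨i.1.2, rfl⟩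
    · rintro ⟨s, rfl⟩
      -- some `l` with `(e s).symm l ∈ α` exists since `α` is non-empty
      have hαne : α.Nonempty := by rw [← Finset.card_pos, hα]; exact hd
      obtain ⟨j, hj⟩ := hαne
      exact ⟨⟨(e s j, s), by simpa using hj⟩, rfl⟩
  have hψtop : (⨆ μ ∈ Finset.univ.image ρ, Module.End.eigenspace (complexBetti.map ψ.hom.hom.hom 1).hom μ) = ⊤ := by
    rw [← himg_eq]; exact hψtrans.2
  have hψdim : ∀ μ ∈ Finset.univ.image ρ,
      Module.finrank ℂ (Module.End.eigenspace (complexBetti.map ψ.hom.hom.hom 1).hom μ) = d := by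
    intro μ hμ
    obtain ⟨s, _, rfl⟩ := Finset.mem_image.mp hμ
    rw [hψtrans.1]
    -- `{i : Iα // ρ i.2 = ρ s} ≃ {l // (e s).symm l ∈ α}`, of cardinality `|α| = d`
    have : Fintype.card {i : Iα // ρ i.1.2 = ρ s} = Fintype.card {l : Fin N // (e s).symm l ∈ α} := by
      refine Fintype.card_congr ⟨fun i => ⟨i.1.1.1, by have := i.1.2; rwa [hρ i.2] at this⟩,
        fun l => ⟨⟨(l.1, s), l.2⟩, rfl⟩, ?_, ?_⟩
      · rintro ⟨⟨⟨l, s'⟩, h1⟩, h2⟩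
        have hs' : s' = s := hρ h2
        subst hs'
        rfl
      · intro l
        rfl
    rw [this, Fintype.card_subtype]
    have : (Finset.univ.filter fun l : Fin N => (e s).symm l ∈ α).card = α.card := by
      refine Finset.card_bij (fun l _ => (e s).symm l) (fun l hl => (Finset.mem_filter.mp hl).2)
        (fun l₁ _ l₂ _ h => (e s).symm.injective h) (fun j hj => ⟨e s j, by simpa using hj, by simp⟩)
    rw [this, hα]
  -- (B) the CM endomorphism `φ`: `2 dim` distinct eigenvalues
  have hφtrans := eigenspace_transport (complexBetti.map q.hom.hom.hom 1).hom
    (complexBetti.map φ.hom.hom.hom 1).hom (complexBetti.map V.hom.hom.hom 1).hom hqinj (hinter φ V hφq) b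
    (fun i => val i.1) hbli (fun i => hV i.1.1 i.1.2) hrange
  have hCM : ∃ S : Subalgebra ℚ (endAlgebra (image u)), IsReduced ↥S ∧ (∀ x ∈ S, ∀ y ∈ S, x * y = y * x) ∧
      Module.finrank ℚ ↥S = 2 * (image u).dim := by
    have hcard2 : Fintype.card Iα = 2 * (image u).dim := by rw [hcardI, hdim, hα]
    let enum : Fin (2 * (image u).dim) ≃ Iα := (Fintype.equivFinOfCardEq hcard2).symm
    refine CMPivot.exists_cmSubalgebra_of_eigenvalues (image u) φ (fun k => val (enum k).1) ?_ ?_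
    · intro k k' h
      exact enum.injective (Subtype.ext (hval _ _ (enum k).2 (enum k').2 h))
    · intro k
      have hpos : 0 < Module.finrank ℂ (Module.End.eigenspace (complexBetti.map φ.hom.hom.hom 1).hom (val (enum k).1)) := by
        rw [hφtrans.1, Fintype.card_pos_iff]
        exact ⟨⟨enum k, rfl⟩⟩
      obtain ⟨⟨x, hxmem⟩, hx0⟩ := Module.finrank_pos_iff_exists_ne_zero.mp hpos
      exact Module.End.hasEigenvalue_of_hasEigenvector ⟨hxmem, fun h => hx0 (Subtype.ext h)⟩
  -- (C) descent of classes
  refine ⟨ψ, hCM, fun μ hμ => ?_, hψtop, hψdim, ?_⟩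
  · obtain ⟨s, _, rfl⟩ := Finset.mem_image.mp hμ
    exact hρim s
  intro w ws huw hw hws
  have hNdd : ((Nd : ℂ) ^ d) ≠ 0 := pow_ne_zero _ (Nat.cast_ne_zero.mpr hNd.ne')
  refine ⟨((Nd : ℂ) ^ d)⁻¹ • complexBetti.map sι.hom.hom.hom d w, ?_, ?_, ?_, ?_⟩
  · -- `q^* t = w`
    rw [map_smul]
    have : complexBetti.map q.hom.hom.hom d (complexBetti.map sι.hom.hom.hom d w) = complexBetti.map u.hom.hom.hom d w := by
      rw [← CategoryTheory.comp_apply, ← complexBetti_map_comp_hom, hq, hsι, toImage_imageι]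
    rw [this, huw, smul_smul, inv_mul_cancel₀ hNdd, one_smul]
  · -- rationality
    intro hwr
    have : ((Nd : ℂ) ^ d)⁻¹ = ((((Nd : ℚ) ^ d)⁻¹ : ℚ) : ℂ) := by push_cast; rfl
    rw [this]
    exact (hwr.pullback _).smul _
  · -- Hodge type
    intro p q' hwh
    exact IsOfHodgeType.smul (hwh.map_of_isSmoothProjective hBα hB _) _
  · -- Weil eigen-span
    rw [hw, map_sum, Finset.smul_sum]
    refine Submodule.sum_mem _ fun s _ => ?_
    refine Submodule.smul_mem _ _ ?_
    have hmem : ρ s ∈ Finset.univ.image ρ := Finset.mem_image_of_mem _ (Finset.mem_univ s)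
    refine Submodule.mem_iSup_of_mem (ρ s) (Submodule.mem_iSup_of_mem hmem ?_)
    rw [mem_pullbackEigenclasses_iff]
    intro x y'
    -- `(x•𝟙 + y'•ψ) ≫ sι = sι ≫ (x•𝟙 + y'•Y)`
    have hcomm : (x • 𝟙 (image u) + y' • ψ) ≫ sι = sι ≫ (x • 𝟙 B + y' • Y) := by
      rw [Preadditive.add_comp, Preadditive.comp_add, Preadditive.nsmul_comp, Preadditive.comp_nsmul,
        Preadditive.nsmul_comp, Preadditive.comp_nsmul, Category.id_comp, Category.comp_id, hsι, hψs]
    change complexBetti.map (x • 𝟙 (image u) + y' • ψ).hom.hom.hom d (complexBetti.map sι.hom.hom.hom d (ws s)) = _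
    rw [← CategoryTheory.comp_apply, ← complexBetti_map_comp_hom, hcomm, complexBetti_map_comp_hom,
      CategoryTheory.comp_apply, hws s x y', map_smul]

end Summit.HodgeConjecture.HodgeConjecture.Theorems.HodgeAbelianVarieties.CMPivotAndre

end
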